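/-
Copyright (c) 2026 the pub-hodgecm-mathlib formalisation cell (harness21).  Prover seat hodgecm-mathlib-K2E3-p31 (g0), HCML Track B «K2-LIT»,
h413 = `stmt-HodgeConjecture-24833`, line `K2_E3_EllipticInputs`, unit U12 «Characters», PART «SC» (ED. 2) leaf (SC-an)₂
`sig_K2E3SupercuspidalTruncatedCharAnalyticTwo`, road «FC₂» ∕ (M5h₂) chain — DOCKMASTER deal D161 (LINE-LEAD K2E3-plan (g4) 2026-09-04T15:17:02Z), DOCK A:
THE LIMIT LETTER (LIM₂) OF THE TOP (M5h)₂ PAYER, LETTER-FREE — [M6′]₂ FILE A `RadiusDatumTwo.exists_radius_and_datum` (K2E3-p36 (g0)) with its four `2 × 2` letters FED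
by name, and [M6′]₂ FILE B `LimCancExplicitTwo` (this seat) with its letter `hRD` FED by the former.  2026-09-04.
-/
import Summits.HodgeConjecture.HodgeConjecture.Theorems.K2E3SupercuspidalTruncatedCharLimCancExplicitTwo    -- ★ p861228 [M6′]₂ FILE B (this seat), hypothesis-first over `hRD`
import Summits.HodgeConjecture.HodgeConjecture.Theorems.K2E3SupercuspidalTruncatedCharRadiusDatumTwo         -- ★ p861214 [M6′]₂ FILE A (K2E3-p36 g0), hypothesis-first over `hCART hD2a hD2b hM5d`
import Summits.HodgeConjecture.HodgeConjecture.Theorems.K2E3SupercuspModelFrameAtPlaceCartanTwo              -- ★ p861187 [M2a]₂ FILE B (this seat): (d)₂ `exists_conj_torusU_of_not_isCompact_centralizer` ⟹ `hCART`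
import Summits.HodgeConjecture.HodgeConjecture.Theorems.K2E3ConjugatorHeightControlRankOneTwo                -- ★ p861205 (D2)₂ (K2E3-p36 g0): `exists_conjugator_mem_heightBall` ⟹ `hD2a`, `mem_heightBall_mul_torusU_of_conj_mem_support` ⟹ `hD2b`
import Summits.HodgeConjecture.HodgeConjecture.Theorems.K2E3SupercuspidalTruncatedCharThm20RadiusTwoCoeff     -- (M5d)₂ COEFFICIENT FORM (K2E3-p14 g8): `setIntegral_sdiff_heightBall_coeff_conj_eq_zero_of_subset` ⟹ `hM5d` (Theorem 20 ★ K2E3-p32 inside)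
import HarnessLib

/-!
# K2_E3 road (h413), socket (SC-an)₂, (M5h₂) chain — DOCK A: THE TOP PAYER'S LIMIT LETTER (LIM₂) LETTER-FREE — [M6′]₂ «EXPLICIT Bset» FILES A AND B WITH EVERY
# `2 × 2` LETTER FED BY NAME (Harish-Chandra 1970, Part VII §2 Theorem 20, Cor. of Thm 18; §3 p. 71 eq. (1), (ii), p. 72; Part I §3 Lemma 14)

Cell `pub/hodgecm-mathlib`, Track B «K2-LIT», crux H413 = `stmt-HodgeConjecture-24833` (`--supports … --as helper`, count-neutral); L4 LINE-LEAD K2E3-plan (g4) D161 («(M5h)₂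
DOCKMASTER: ONE hand owns every letter-free re-cut ∕ dock edition of this cone as letters turn ★ + BUILT»); consumer: the TOP (M5h)₂ payer K2E3-p23 (g7) ∕ K2E3-p30 (g0) ∕ desk
K2E3-p27 (g0), whose socket tie `sigSCanTwo_of_ellWeightPlace_two (hLIM hSHELL hTOK hTORΩ hDEPTH)` reads **`hLIM` = the statement of `explicit_limit_localisation_and_hball_reduction`
below** (∀-closed over `(L) … (u u')`, `H := Φ₂`).  THEOREMS ONLY (no `def`, no `instance`, no `notation`, no named-fact hypothesis, no `sorry`); ★-only imports.

THE DOCK (no new mathematics — every body is one application of a ★ head with its letters fed by ★ names):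
* **`exists_radius_and_datum`** = ★ p861214 `K2E3SupercuspidalTruncatedCharRadiusDatumTwo.exists_radius_and_datum` (K2E3-p36 (g0); its binders after the four letters VERBATIM) with
  `hCART :=` ★ p861187 `K2E3SupercuspModelFrameAtPlaceCartanTwo.exists_conj_torusU_of_not_isCompact_centralizer` (this seat; (d)₂ Cartan dichotomy at the place),
  `hD2a :=` ★ p861205 `K2E3ConjugatorHeightControlRankOneTwo.exists_conjugator_mem_heightBall`, `hD2b :=` ★ p861205 `….mem_heightBall_mul_torusU_of_conj_mem_support` (K2E3-p36 (g0);
  the three terms are p36's kernel-verified docks, `K2/STATUS.md` 2026-09-04T15:12:22Z (2)), `hM5d :=` K2E3-p14 (g8)'s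
  `K2E3SupercuspidalTruncatedCharThm20RadiusTwoCoeff.setIntegral_sdiff_heightBall_coeff_conj_eq_zero_of_subset` ((M5d)₂ coefficient form, explicit radius `m_C + (1 + 2s + 4m_C) + s`,
  over ★ K2E3-p32 (g0)'s Theorem 20 `K2E3CuspFormCancellationU2LevelOne.cuspForm_cancellation_levelOne_U2`, ★ p861233 [M1]₂, ★ p861231 (M5d)₂ any-rank) — binder for binder the `hM5d`
  letter text (positional `fun`, `hσ`∕`h2` passed through as the Coeff head keeps them as `_`-binders).
* **`exists_explicit_exhaustion_radius`**, **`explicit_limit_localisation_and_hball_reduction`** = ★ p861228 `K2E3SupercuspidalTruncatedCharLimCancExplicitTwo` heads (this seat) with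
  `hRD := fun μM _ ρM hsmM hscM hBinvM _ hθ m ↦ exists_radius_and_datum L w hw rfl μM ΩM hϖ hmem hinv hmul ρM hsmM hscM B hBinvM u u' hθ m`; BINDERS = ★ [M6′]
  `K2E3SupercuspidalTruncatedCharLimCancExplicit`'s TEMPLATE list with `3 ↦ 2` (`(ΩM) {ϖ} (hϖ) (hmem) (hinv) (hmul) {V} (ρ) …` — the four Ω-letters are BACK, `hRD` is GONE), general
  hermitian `H ∈ M₂(L)` (the payer's `hLIM` is the instance `H := Φ₂`: `hLIM := fun L _ _ _ ↦ explicit_limit_localisation_and_hball_reduction L _`), `{V : Type u}`.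
After this file the LIM₂ letter of the (M5h)₂ socket carries NO named letter: ★ [M2a]₂ A∕B, ★ SingularLocusNull₂, ★ (D2)₂, ★ [M1]₂, ★ [M3]₂ = U2Torus ∕ InputsAnyRank ∕ U2Inputs ∕ U2LevelOne,
★ (M5d)₂ any-rank + Coeff, ★ [M6′]₂ A∕B, ★ GENERIC [M5′] transport ∕ (f1) ∕ [M6] §1.

HONEST LABEL: HC_CM is proved only modulo the 7 printed citations (2 remaining named inputs: hLiu418 = stmt-HodgeConjecture-24832, h413 =
stmt-HodgeConjecture-24833) until rung 0 closes; this file is a count-neutral helper; it closes the LIM₂ LETTER, not the socket: (SC-an)₂ stays OPEN until `hSHELL`, `hTOK`,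
`hTORΩ`, `hDEPTH` + COLL₂ + NC₂ are ★ and PART «SC» is re-tied.

## References
* [HarishChandra1970] Harish-Chandra (notes by G. van Dijk), *Harmonic Analysis on Reductive p-adic Groups*, LNM 162 (1970), Part VII §2 Theorem 20 p. 70, Cor. of Thm 18 p. 69;
  §3 p. 71 eq. (1), (ii), p. 72; Part I §3 Lemma 14 p. 9; Part V Lemma 42.
* [Rogawski1990] J. D. Rogawski, *Automorphic Representations of Unitary Groups in Three Variables*, Ann. of Math. Stud. 123 (1990), §3.1 p. 19, §3.6 pp. 28–31, §4.9 p. 54,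
  §12.2 p. 173, §12.5 p. 182.
* [PlatonovRapinchuk1994] V. Platonov, A. Rapinchuk, *Algebraic Groups and Number Theory* (1994), §5.1.
* [Folland1995] G. B. Folland, *A Course in Abstract Harmonic Analysis* (1995), §2.4.
-/

set_option autoImplicit false
-- the mandated namespace repeats the single-problem summit's segment (`HodgeConjecture.HodgeConjecture`)
set_option linter.dupNamespace false

noncomputable section

open MeasureTheory Measure Set Filter Topology NumberField IsDedekindDomain
open scoped NNReal ENNReal Pointwise Matrix MatrixGroups WithZero
open ValuativeRel
open Literature.NumberTheory.Automorphic Literature.NumberTheory.Automorphic.UnitaryGroup Literature.NumberTheory.Rogawski1990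
open Literature.NumberTheory.GaloisRepresentations

universe u

namespace Summit.HodgeConjecture.HodgeConjecture.Cruxes.H413.K2E3SupercuspidalTruncatedCharLimCancLetterFreeTwo

variable (L : Type) [Field L] [NumberField L] [IsCMField L]

/-! ## §1 [M6′]₂ FILE A letter-free: a radius for every element of `U(σ_w, Φ₂)(L_w)`, with the datum at split-regular elements -/

set_option maxHeartbeats 800000 in
-- the statement is long (the [M6′] FILE A conclusion on the one-place carrier); same class as ★ p861228's 800000
/-- **A RADIUS FOR EVERY ELEMENT OF THE MODEL `U(σ_w, Φ₂)(L_w)`, WITH THE DATUM READ OFF AT SPLIT-REGULAR ELEMENTS — LETTER-FREE.**  ★ p861214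
`K2E3SupercuspidalTruncatedCharRadiusDatumTwo.exists_radius_and_datum` (K2E3-p36 (g0)) with `hCART :=` ★ p861187 (d)₂, `hD2a`∕`hD2b :=` ★ p861205 (D2a∕b)₂, `hM5d :=` K2E3-p14 (g8)'s
(M5d)₂ coefficient head (Theorem 20 ★ K2E3-p32 inside).  CONCLUSION (verbatim): for every `m ∈ M` ONE radius `R` with (i) `m` regular ⇒ `∫_{Ω n ∖ Ω R} θ_M(x m x⁻¹) dμ = 0` for every `n`;
(ii) `m` regular with NON-compact centraliser ⇒ `R = 5(2m_θ + 2λ) + 3(2m_g + 2λ) + 1` for a DATUM `(t, d, y₀, λ, m_g)`.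
[cite: HarishChandra1970, Part VII §2 Theorem 20 p. 70, Cor. of Thm 18 p. 69; §3 p. 71 eq. (1), (ii); Part I §3 Lemma 14 p. 9] [cite: Rogawski1990, §3.6 pp. 28–31, §4.9 p. 54, §12.2 p. 173] -/
theorem exists_radius_and_datum {v : HeightOneSpectrum (𝓞 ↥(maximalRealSubfield L))} (w : PlacesOver L v) (hw : IsCMField.complexConj L • w.1 = w.1)
    {J : Matrix (Fin 2) (Fin 2) (w.1.adicCompletion L)}
    (hJ : J = (StdForm.antidiagonal 2).over (w.1.adicCompletion L))
    [MeasurableSpace ↥(unitaryGroupOfForm (galAdicCompletionMap (L := L) (IsCMField.complexConj L) hw) J)]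
    [BorelSpace ↥(unitaryGroupOfForm (galAdicCompletionMap (L := L) (IsCMField.complexConj L) hw) J)]
    (μ : Measure ↥(unitaryGroupOfForm (galAdicCompletionMap (L := L) (IsCMField.complexConj L) hw) J)) [μ.IsHaarMeasure]
    (Ω : CompactExhaustion ↥(unitaryGroupOfForm (galAdicCompletionMap (L := L) (IsCMField.complexConj L) hw) J)) {ϖ : w.1.adicCompletion L}
    (hϖ : Valued.v ϖ = WithZero.exp (-1 : ℤ))
    (hmem : ∀ (m : ℕ) (g : ↥(unitaryGroupOfForm (galAdicCompletionMap (L := L) (IsCMField.complexConj L) hw) J)), g ∈ Ω m ↔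
      (∀ i j, Valued.v (ϖ ^ m * ((g : GL (Fin 2) (w.1.adicCompletion L)) : Matrix (Fin 2) (Fin 2) (w.1.adicCompletion L)) i j) ≤ 1) ∧
        ∀ i j, Valued.v (ϖ ^ m * (((g : GL (Fin 2) (w.1.adicCompletion L))⁻¹ : GL (Fin 2) (w.1.adicCompletion L)) :
          Matrix (Fin 2) (Fin 2) (w.1.adicCompletion L)) i j) ≤ 1)
    (hinv : ∀ (m : ℕ) (g : ↥(unitaryGroupOfForm (galAdicCompletionMap (L := L) (IsCMField.complexConj L) hw) J)), g ∈ Ω m → g⁻¹ ∈ Ω m)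
    (hmul : ∀ (a b : ℕ) (g h : ↥(unitaryGroupOfForm (galAdicCompletionMap (L := L) (IsCMField.complexConj L) hw) J)), g ∈ Ω a → h ∈ Ω b → g * h ∈ Ω (a + b))
    {V : Type u} [AddCommGroup V] [Module ℂ V]
    (ρ : Representation ℂ ↥(unitaryGroupOfForm (galAdicCompletionMap (L := L) (IsCMField.complexConj L) hw) J) V) (hsm : ρ.IsSmooth) (hsc : ρ.IsSupercuspidal)
    (B : V →ₗ⋆[ℂ] V →ₗ[ℂ] ℂ)
    (hBinv : ∀ (g : ↥(unitaryGroupOfForm (galAdicCompletionMap (L := L) (IsCMField.complexConj L) hw) J)) (x y : V), B (ρ g x) (ρ g y) = B x y) (u u' : V)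
    {mθ : ℕ} (hθ : ∀ g : ↥(unitaryGroupOfForm (galAdicCompletionMap (L := L) (IsCMField.complexConj L) hw) J), B u' (ρ g u) ≠ 0 → g ∈ Ω mθ)
    (m : ↥(unitaryGroupOfForm (galAdicCompletionMap (L := L) (IsCMField.complexConj L) hw) J)) :
    ∃ R : ℕ,
      (IsRegularElt (m : GL (Fin 2) (w.1.adicCompletion L)) → ∀ n : ℕ, ∫ x in Ω n \ Ω R, B u' (ρ (x * m * x⁻¹) u) ∂μ = 0) ∧
      (IsRegularElt (m : GL (Fin 2) (w.1.adicCompletion L)) →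
        ¬ IsCompact ((Subgroup.centralizer ({m} : Set ↥(unitaryGroupOfForm (galAdicCompletionMap (L := L) (IsCMField.complexConj L) hw) J)) :
          Subgroup ↥(unitaryGroupOfForm (galAdicCompletionMap (L := L) (IsCMField.complexConj L) hw) J)) :
            Set ↥(unitaryGroupOfForm (galAdicCompletionMap (L := L) (IsCMField.complexConj L) hw) J)) →
        ∃ (t y₀ : ↥(unitaryGroupOfForm (galAdicCompletionMap (L := L) (IsCMField.complexConj L) hw) J)) (d : Fin 2 → (w.1.adicCompletion L)ˣ) (lam mg : ℕ),
          glDiagonal 2 (w.1.adicCompletion L) d = (t : GL (Fin 2) (w.1.adicCompletion L)) ∧ IsRegularElt (t : GL (Fin 2) (w.1.adicCompletion L)) ∧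
          (∀ i k : Fin 2, i ≠ k → Valued.v (ϖ ^ lam) ≤ Valued.v ((d i : w.1.adicCompletion L) - d k)) ∧
          (∀ lam' : ℕ, (∀ i k : Fin 2, i ≠ k → Valued.v (ϖ ^ lam') ≤ Valued.v ((d i : w.1.adicCompletion L) - d k)) → lam ≤ lam') ∧
          m ∈ Ω mg ∧ (∀ m' : ℕ, m ∈ Ω m' → mg ≤ m') ∧
          y₀ ∈ Ω (2 * mg + 2 * lam) ∧ m = y₀ * t * y₀⁻¹ ∧
          R = 5 * (2 * mθ + 2 * lam) + 3 * (2 * mg + 2 * lam) + 1) :=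
  K2E3SupercuspidalTruncatedCharRadiusDatumTwo.exists_radius_and_datum L w hw
    (fun L' _ _ _ _ w' hw' _ hJ' _ hreg hnc =>
      K2E3SupercuspModelFrameAtPlaceCartanTwo.exists_conj_torusU_of_not_isCompact_centralizer L' w' hw' hJ' hreg hnc)
    (fun _ _ _ σ hσv hσσ _ hJ _ hϖ Ω hmem _ _ _ _ hd _ hlam _ hgΩ hgy =>
      K2E3ConjugatorHeightControlRankOneTwo.exists_conjugator_mem_heightBall σ hσv hσσ hJ hϖ Ω hmem hd hlam hgΩ hgy)
    (fun _ _ _ σ hσv hσσ _ hJ _ hϖ Ω hmem _ _ θ _ hθ _ _ hd _ hlam =>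
      K2E3ConjugatorHeightControlRankOneTwo.mem_heightBall_mul_torusU_of_conj_mem_support σ hσv hσσ hJ hϖ Ω hmem θ hθ hd hlam)
    (fun K _ _ _ _ _ _ _ _ _ σ hσ hσc hσv h2 _ hJ _ _ _ _ μ _ _ _ hϖ _ hϖ'0 hϖ'1 hσϖ' hZs hZc Ω hmem hinv hmul _ _ _ ρ hsm hsc B hBinv u u' t _ hd hreg C _ hC hsupp _ _ hy n =>
      K2E3SupercuspidalTruncatedCharThm20RadiusTwoCoeff.setIntegral_sdiff_heightBall_coeff_conj_eq_zero_of_subset (K := K) σ hσ hσc hσv h2 hJ μ hϖ hϖ'0 hϖ'1 hσϖ'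
        hZs hZc Ω hmem hinv hmul ρ hsm hsc B hBinv u u' t hd hreg C hC hsupp hy n)
    hJ μ Ω hϖ hmem hinv hmul ρ hsm hsc B hBinv u u' hθ m

/-! ## §2 [M6′]₂ FILE B letter-free on `G = (cmDatum L 2 H).Local v`: the TOP payer's `hLIM` (at `H := Φ₂`) -/

section Carrier

variable (H : Matrix (Fin 2) (Fin 2) L)

set_option maxHeartbeats 800000 in
-- the statement is long (six exported clauses on the CM ∕ one-place carriers); same class as ★ p861228's 800000
/-- **[M6′]₂ MAIN — EXPLICIT EXHAUSTION AND RADIUS ALONG A FIELD MODEL, LETTER-FREE.**  ★ p861228 `K2E3SupercuspidalTruncatedCharLimCancExplicitTwo.exists_explicit_exhaustion_radius` with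
`hRD :=` §1; binders = ★ [M6′] `…LimCancExplicit`'s template list with `3 ↦ 2`.  `G = (cmDatum L 2 H).Local v`, `e : G ≃ₜ* M = U(σ_w, Φ₂)(L_w)`, `Ω_M` the height balls of `M` (`hmem` `hinv`
`hmul`), `θ = B u′ (ρ(·) u)` a supercuspidal coefficient: exhaustion pull-back, support height, `hcanc`∕`hlim` a.e. guard-free, the DATUM clause `R g = 5(2m_θ + 2λ) + 3(2m_g + 2λ) + 1`,
`e g` regular a.e., the transport identity. [cite: HarishChandra1970, Part VII §3 p. 71 eq. (1), (ii), p. 72; §2 Theorem 20 p. 70] [cite: Rogawski1990, §12.2 p. 173, §12.5 p. 182]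
[cite: PlatonovRapinchuk1994, §5.1] [cite: Folland1995, §2.4] -/
theorem exists_explicit_exhaustion_radius
    {v : HeightOneSpectrum (𝓞 ↥(maximalRealSubfield L))} (w : PlacesOver L v) (hw : IsCMField.complexConj L • w.1 = w.1)
    [MeasurableSpace ((UnitaryGroup.cmDatum L 2 H).Local v)] [BorelSpace ((UnitaryGroup.cmDatum L 2 H).Local v)]
    (μ : Measure ((UnitaryGroup.cmDatum L 2 H).Local v)) [μ.IsHaarMeasure]
    [MeasurableSpace ↥(unitaryGroupOfForm (galAdicCompletionMap (L := L) (IsCMField.complexConj L) hw) ((StdForm.antidiagonal 2).over (w.1.adicCompletion L)))]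
    [BorelSpace ↥(unitaryGroupOfForm (galAdicCompletionMap (L := L) (IsCMField.complexConj L) hw) ((StdForm.antidiagonal 2).over (w.1.adicCompletion L)))]
    (e : (UnitaryGroup.cmDatum L 2 H).Local v ≃ₜ*
      ↥(unitaryGroupOfForm (galAdicCompletionMap (L := L) (IsCMField.complexConj L) hw) ((StdForm.antidiagonal 2).over (w.1.adicCompletion L))))
    (ΩM : CompactExhaustion ↥(unitaryGroupOfForm (galAdicCompletionMap (L := L) (IsCMField.complexConj L) hw) ((StdForm.antidiagonal 2).over (w.1.adicCompletion L))))
    {ϖ : w.1.adicCompletion L} (hϖ : Valued.v ϖ = WithZero.exp (-1 : ℤ))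
    (hmem : ∀ (m : ℕ) (g : ↥(unitaryGroupOfForm (galAdicCompletionMap (L := L) (IsCMField.complexConj L) hw) ((StdForm.antidiagonal 2).over (w.1.adicCompletion L)))),
      g ∈ ΩM m ↔
      (∀ i j, Valued.v (ϖ ^ m * ((g : GL (Fin 2) (w.1.adicCompletion L)) : Matrix (Fin 2) (Fin 2) (w.1.adicCompletion L)) i j) ≤ 1) ∧
        ∀ i j, Valued.v (ϖ ^ m * (((g : GL (Fin 2) (w.1.adicCompletion L))⁻¹ : GL (Fin 2) (w.1.adicCompletion L)) :
          Matrix (Fin 2) (Fin 2) (w.1.adicCompletion L)) i j) ≤ 1)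
    (hinv : ∀ (m : ℕ) (g : ↥(unitaryGroupOfForm (galAdicCompletionMap (L := L) (IsCMField.complexConj L) hw) ((StdForm.antidiagonal 2).over (w.1.adicCompletion L)))),
      g ∈ ΩM m → g⁻¹ ∈ ΩM m)
    (hmul : ∀ (a b : ℕ) (g h : ↥(unitaryGroupOfForm (galAdicCompletionMap (L := L) (IsCMField.complexConj L) hw) ((StdForm.antidiagonal 2).over (w.1.adicCompletion L)))),
      g ∈ ΩM a → h ∈ ΩM b → g * h ∈ ΩM (a + b))
    {V : Type u} [AddCommGroup V] [Module ℂ V] (ρ : Representation ℂ ((UnitaryGroup.cmDatum L 2 H).Local v) V) (hsm : ρ.IsSmooth) (hsc : ρ.IsSupercuspidal)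
    (B : V →ₗ⋆[ℂ] V →ₗ[ℂ] ℂ) (hBinv : ∀ (g : (UnitaryGroup.cmDatum L 2 H).Local v) (x y : V), B (ρ g x) (ρ g y) = B x y) (u u' : V) :
    ∃ (Ω : CompactExhaustion ((UnitaryGroup.cmDatum L 2 H).Local v)) (R : (UnitaryGroup.cmDatum L 2 H).Local v → ℕ) (mθ : ℕ),
      (∀ n : ℕ, (Ω n : Set ((UnitaryGroup.cmDatum L 2 H).Local v)) = e ⁻¹' (ΩM n)) ∧
      (∀ m' : ↥(unitaryGroupOfForm (galAdicCompletionMap (L := L) (IsCMField.complexConj L) hw) ((StdForm.antidiagonal 2).over (w.1.adicCompletion L))),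
        B u' (ρ (e.symm m') u) ≠ 0 → m' ∈ ΩM mθ) ∧
      (∀ᵐ g ∂μ, (∀ n : ℕ, ∫ x in Ω n, B u' (ρ (x * g * x⁻¹) u) ∂μ = ∫ x in Ω n ∩ Ω (R g), B u' (ρ (x * g * x⁻¹) u) ∂μ) ∧
        Tendsto (fun n : ℕ => ∫ x in Ω n, B u' (ρ (x * g * x⁻¹) u) ∂μ) atTop (𝓝 (∫ x in Ω (R g), B u' (ρ (x * g * x⁻¹) u) ∂μ))) ∧
      (∀ g : (UnitaryGroup.cmDatum L 2 H).Local v, IsRegularElt ((e g : ↥(unitaryGroupOfForm (galAdicCompletionMap (L := L) (IsCMField.complexConj L) hw)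
          ((StdForm.antidiagonal 2).over (w.1.adicCompletion L)))) : GL (Fin 2) (w.1.adicCompletion L)) →
        ¬ IsCompact ((Subgroup.centralizer ({g} : Set ((UnitaryGroup.cmDatum L 2 H).Local v))) : Set ((UnitaryGroup.cmDatum L 2 H).Local v)) →
        ∃ (t y₀ : ↥(unitaryGroupOfForm (galAdicCompletionMap (L := L) (IsCMField.complexConj L) hw) ((StdForm.antidiagonal 2).over (w.1.adicCompletion L))))
          (d : Fin 2 → (w.1.adicCompletion L)ˣ) (lam mg : ℕ),
          glDiagonal 2 (w.1.adicCompletion L) d = (t : GL (Fin 2) (w.1.adicCompletion L)) ∧ IsRegularElt (t : GL (Fin 2) (w.1.adicCompletion L)) ∧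
          (∀ i k : Fin 2, i ≠ k → Valued.v (ϖ ^ lam) ≤ Valued.v ((d i : w.1.adicCompletion L) - d k)) ∧
          (∀ lam' : ℕ, (∀ i k : Fin 2, i ≠ k → Valued.v (ϖ ^ lam') ≤ Valued.v ((d i : w.1.adicCompletion L) - d k)) → lam ≤ lam') ∧
          e g ∈ ΩM mg ∧ (∀ m' : ℕ, e g ∈ ΩM m' → mg ≤ m') ∧
          y₀ ∈ ΩM (2 * mg + 2 * lam) ∧ e g = y₀ * t * y₀⁻¹ ∧
          R g = 5 * (2 * mθ + 2 * lam) + 3 * (2 * mg + 2 * lam) + 1) ∧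
      (∀ᵐ g ∂μ, IsRegularElt ((e g : ↥(unitaryGroupOfForm (galAdicCompletionMap (L := L) (IsCMField.complexConj L) hw)
          ((StdForm.antidiagonal 2).over (w.1.adicCompletion L)))) : GL (Fin 2) (w.1.adicCompletion L))) ∧
      (∀ (g : (UnitaryGroup.cmDatum L 2 H).Local v)
        (S : Set ↥(unitaryGroupOfForm (galAdicCompletionMap (L := L) (IsCMField.complexConj L) hw) ((StdForm.antidiagonal 2).over (w.1.adicCompletion L)))),
        ∫ x in e ⁻¹' S, ‖B u' (ρ (x * g * x⁻¹) u)‖ ∂μ = ∫ x' in S, ‖B u' (ρ (e.symm (x' * e g * x'⁻¹)) u)‖ ∂(μ.map e)) :=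
  K2E3SupercuspidalTruncatedCharLimCancExplicitTwo.exists_explicit_exhaustion_radius L H w hw μ e ΩM ρ hsm hsc B hBinv u u'
    (fun μM _ ρM hsmM hscM hBinvM _ hθ m => exists_radius_and_datum L w hw rfl μM ΩM hϖ hmem hinv hmul ρM hsmM hscM B hBinvM u u' hθ m)

set_option maxHeartbeats 800000 in
-- the statement is long (ten exported clauses on the CM ∕ one-place carriers); same class as ★ p861228's 800000
/-- **[M6′]₂ IN THE CONSUMERS' BINDERS, WITH THE EXPLICIT BALL AND THE `hball` REDUCTION — LETTER-FREE = THE TOP PAYER'S `hLIM`** (K2E3-p23 (g7)'s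
`sigSCanTwo_of_ellWeightPlace_two`'s first letter is THIS statement ∀-closed at `H := Φ₂`).  ★ p861228 `…LimCancExplicitTwo.explicit_limit_localisation_and_hball_reduction` with `hRD :=` §1:
a compact exhaustion `Ω = e⁻¹ Ω_M`, a radius `R`, a support height `m_θ`, `F g := Θ_{R g}(g)`, `Bset g := Ω (R g)` such that `hlim`∕`hcanc` hold token for token, the DATUM clause describes
`R g` at every `g` with `e g` regular and `Z_G(g)` non-compact, `e g` is regular a.e., and `hball_of_model_bound` ∕ `hballE_of_model_bound` reduce the domination bricks to MODEL inequalities.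
[cite: HarishChandra1970, Part VII §3 pp. 70–73; Thms 14, 18–20] [cite: Rogawski1990, §12.2 p. 173, §12.5 p. 182] [cite: Folland1995, §2.4] -/
theorem explicit_limit_localisation_and_hball_reduction
    {v : HeightOneSpectrum (𝓞 ↥(maximalRealSubfield L))} (w : PlacesOver L v) (hw : IsCMField.complexConj L • w.1 = w.1)
    [MeasurableSpace ((UnitaryGroup.cmDatum L 2 H).Local v)] [BorelSpace ((UnitaryGroup.cmDatum L 2 H).Local v)]
    (μ : Measure ((UnitaryGroup.cmDatum L 2 H).Local v)) [μ.IsHaarMeasure]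
    [MeasurableSpace ↥(unitaryGroupOfForm (galAdicCompletionMap (L := L) (IsCMField.complexConj L) hw) ((StdForm.antidiagonal 2).over (w.1.adicCompletion L)))]
    [BorelSpace ↥(unitaryGroupOfForm (galAdicCompletionMap (L := L) (IsCMField.complexConj L) hw) ((StdForm.antidiagonal 2).over (w.1.adicCompletion L)))]
    (e : (UnitaryGroup.cmDatum L 2 H).Local v ≃ₜ*
      ↥(unitaryGroupOfForm (galAdicCompletionMap (L := L) (IsCMField.complexConj L) hw) ((StdForm.antidiagonal 2).over (w.1.adicCompletion L))))
    (ΩM : CompactExhaustion ↥(unitaryGroupOfForm (galAdicCompletionMap (L := L) (IsCMField.complexConj L) hw) ((StdForm.antidiagonal 2).over (w.1.adicCompletion L))))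
    {ϖ : w.1.adicCompletion L} (hϖ : Valued.v ϖ = WithZero.exp (-1 : ℤ))
    (hmem : ∀ (m : ℕ) (g : ↥(unitaryGroupOfForm (galAdicCompletionMap (L := L) (IsCMField.complexConj L) hw) ((StdForm.antidiagonal 2).over (w.1.adicCompletion L)))),
      g ∈ ΩM m ↔
      (∀ i j, Valued.v (ϖ ^ m * ((g : GL (Fin 2) (w.1.adicCompletion L)) : Matrix (Fin 2) (Fin 2) (w.1.adicCompletion L)) i j) ≤ 1) ∧
        ∀ i j, Valued.v (ϖ ^ m * (((g : GL (Fin 2) (w.1.adicCompletion L))⁻¹ : GL (Fin 2) (w.1.adicCompletion L)) :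
          Matrix (Fin 2) (Fin 2) (w.1.adicCompletion L)) i j) ≤ 1)
    (hinv : ∀ (m : ℕ) (g : ↥(unitaryGroupOfForm (galAdicCompletionMap (L := L) (IsCMField.complexConj L) hw) ((StdForm.antidiagonal 2).over (w.1.adicCompletion L)))),
      g ∈ ΩM m → g⁻¹ ∈ ΩM m)
    (hmul : ∀ (a b : ℕ) (g h : ↥(unitaryGroupOfForm (galAdicCompletionMap (L := L) (IsCMField.complexConj L) hw) ((StdForm.antidiagonal 2).over (w.1.adicCompletion L)))),
      g ∈ ΩM a → h ∈ ΩM b → g * h ∈ ΩM (a + b))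
    {V : Type u} [AddCommGroup V] [Module ℂ V] (ρ : Representation ℂ ((UnitaryGroup.cmDatum L 2 H).Local v) V) (hsm : ρ.IsSmooth) (hsc : ρ.IsSupercuspidal)
    (B : V →ₗ⋆[ℂ] V →ₗ[ℂ] ℂ) (hBinv : ∀ (g : (UnitaryGroup.cmDatum L 2 H).Local v) (x y : V), B (ρ g x) (ρ g y) = B x y) (u u' : V) :
    ∃ (Ω : CompactExhaustion ((UnitaryGroup.cmDatum L 2 H).Local v)) (R : (UnitaryGroup.cmDatum L 2 H).Local v → ℕ) (mθ : ℕ)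
      (F : (UnitaryGroup.cmDatum L 2 H).Local v → ℂ) (Bset : (UnitaryGroup.cmDatum L 2 H).Local v → Set ((UnitaryGroup.cmDatum L 2 H).Local v)),
      (∀ n : ℕ, (Ω n : Set ((UnitaryGroup.cmDatum L 2 H).Local v)) = e ⁻¹' (ΩM n)) ∧
      (∀ g, Bset g = e ⁻¹' (ΩM (R g))) ∧ (∀ g, IsCompact (Bset g)) ∧
      -- `hlim` of ★ p856184 and `hcanc` of ★ p856355, token for token
      (∀ᵐ g ∂μ, ¬ (IsRegularElt (g.val : GL (Fin 2) (UnitaryGroup.LocalRing L v)) ∧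
          IsCompact ((Subgroup.centralizer ({g} : Set ((UnitaryGroup.cmDatum L 2 H).Local v))) : Set ((UnitaryGroup.cmDatum L 2 H).Local v))) →
        Tendsto (fun n => ∫ x in Ω n, B u' (ρ (x * g * x⁻¹) u) ∂μ) atTop (𝓝 (F g))) ∧
      (∀ n : ℕ, ∀ᵐ g ∂μ, ¬ (IsRegularElt (g.val : GL (Fin 2) (UnitaryGroup.LocalRing L v)) ∧
          IsCompact ((Subgroup.centralizer ({g} : Set ((UnitaryGroup.cmDatum L 2 H).Local v))) : Set ((UnitaryGroup.cmDatum L 2 H).Local v))) →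
        ∫ x in Ω n, B u' (ρ (x * g * x⁻¹) u) ∂μ = ∫ x in Ω n ∩ Bset g, B u' (ρ (x * g * x⁻¹) u) ∂μ) ∧
      -- support height and the DATUM of the radius
      (∀ m' : ↥(unitaryGroupOfForm (galAdicCompletionMap (L := L) (IsCMField.complexConj L) hw) ((StdForm.antidiagonal 2).over (w.1.adicCompletion L))),
        B u' (ρ (e.symm m') u) ≠ 0 → m' ∈ ΩM mθ) ∧
      (∀ g : (UnitaryGroup.cmDatum L 2 H).Local v, IsRegularElt ((e g : ↥(unitaryGroupOfForm (galAdicCompletionMap (L := L) (IsCMField.complexConj L) hw)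
          ((StdForm.antidiagonal 2).over (w.1.adicCompletion L)))) : GL (Fin 2) (w.1.adicCompletion L)) →
        ¬ IsCompact ((Subgroup.centralizer ({g} : Set ((UnitaryGroup.cmDatum L 2 H).Local v))) : Set ((UnitaryGroup.cmDatum L 2 H).Local v)) →
        ∃ (t y₀ : ↥(unitaryGroupOfForm (galAdicCompletionMap (L := L) (IsCMField.complexConj L) hw) ((StdForm.antidiagonal 2).over (w.1.adicCompletion L))))
          (d : Fin 2 → (w.1.adicCompletion L)ˣ) (lam mg : ℕ),
          glDiagonal 2 (w.1.adicCompletion L) d = (t : GL (Fin 2) (w.1.adicCompletion L)) ∧ IsRegularElt (t : GL (Fin 2) (w.1.adicCompletion L)) ∧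
          (∀ i k : Fin 2, i ≠ k → Valued.v (ϖ ^ lam) ≤ Valued.v ((d i : w.1.adicCompletion L) - d k)) ∧
          (∀ lam' : ℕ, (∀ i k : Fin 2, i ≠ k → Valued.v (ϖ ^ lam') ≤ Valued.v ((d i : w.1.adicCompletion L) - d k)) → lam ≤ lam') ∧
          e g ∈ ΩM mg ∧ (∀ m' : ℕ, e g ∈ ΩM m' → mg ≤ m') ∧
          y₀ ∈ ΩM (2 * mg + 2 * lam) ∧ e g = y₀ * t * y₀⁻¹ ∧
          R g = 5 * (2 * mθ + 2 * lam) + 3 * (2 * mg + 2 * lam) + 1) ∧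
      (∀ᵐ g ∂μ, IsRegularElt ((e g : ↥(unitaryGroupOfForm (galAdicCompletionMap (L := L) (IsCMField.complexConj L) hw)
          ((StdForm.antidiagonal 2).over (w.1.adicCompletion L)))) : GL (Fin 2) (w.1.adicCompletion L))) ∧
      -- `hball_of_model_bound` (★ p856355's `hball` for `W := W_M ∘ e`)
      (∀ W_M : ↥(unitaryGroupOfForm (galAdicCompletionMap (L := L) (IsCMField.complexConj L) hw) ((StdForm.antidiagonal 2).over (w.1.adicCompletion L))) → ℝ,
        (∀ᵐ g ∂μ, ¬ (IsRegularElt (g.val : GL (Fin 2) (UnitaryGroup.LocalRing L v)) ∧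
            IsCompact ((Subgroup.centralizer ({g} : Set ((UnitaryGroup.cmDatum L 2 H).Local v))) : Set ((UnitaryGroup.cmDatum L 2 H).Local v))) →
          ∫ x' in ΩM (R g), ‖B u' (ρ (e.symm (x' * e g * x'⁻¹)) u)‖ ∂(μ.map e) ≤ W_M (e g)) →
        ∀ᵐ g ∂μ, ¬ (IsRegularElt (g.val : GL (Fin 2) (UnitaryGroup.LocalRing L v)) ∧
            IsCompact ((Subgroup.centralizer ({g} : Set ((UnitaryGroup.cmDatum L 2 H).Local v))) : Set ((UnitaryGroup.cmDatum L 2 H).Local v))) →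
          ∫ x in Bset g, ‖B u' (ρ (x * g * x⁻¹) u)‖ ∂μ ≤ W_M (e g)) ∧
      -- `hballE_of_model_bound` (★ p856355's `hballE` for `W := W_M ∘ e`)
      (∀ W_M : ↥(unitaryGroupOfForm (galAdicCompletionMap (L := L) (IsCMField.complexConj L) hw) ((StdForm.antidiagonal 2).over (w.1.adicCompletion L))) → ℝ,
        (∀ᵐ g ∂μ, (IsRegularElt (g.val : GL (Fin 2) (UnitaryGroup.LocalRing L v)) ∧
            IsCompact ((Subgroup.centralizer ({g} : Set ((UnitaryGroup.cmDatum L 2 H).Local v))) : Set ((UnitaryGroup.cmDatum L 2 H).Local v))) →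
          ∫ x', ‖B u' (ρ (e.symm (x' * e g * x'⁻¹)) u)‖ ∂(μ.map e) ≤ W_M (e g)) →
        ∀ᵐ g ∂μ, (IsRegularElt (g.val : GL (Fin 2) (UnitaryGroup.LocalRing L v)) ∧
            IsCompact ((Subgroup.centralizer ({g} : Set ((UnitaryGroup.cmDatum L 2 H).Local v))) : Set ((UnitaryGroup.cmDatum L 2 H).Local v))) →
          ∫ x, ‖B u' (ρ (x * g * x⁻¹) u)‖ ∂μ ≤ W_M (e g)) :=
  K2E3SupercuspidalTruncatedCharLimCancExplicitTwo.explicit_limit_localisation_and_hball_reduction L H w hw μ e ΩM ρ hsm hsc B hBinv u u'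
    (fun μM _ ρM hsmM hscM hBinvM _ hθ m => exists_radius_and_datum L w hw rfl μM ΩM hϖ hmem hinv hmul ρM hsmM hscM B hBinvM u u' hθ m)

end Carrier

end Summit.HodgeConjecture.HodgeConjecture.Cruxes.H413.K2E3SupercuspidalTruncatedCharLimCancLetterFreeTwo

end
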